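import Mathlib.Probability.Martingale.OptionalSampling
import Mathlib.MeasureTheory.Function.UniformIntegrable
import Mathlib.MeasureTheory.Function.ConditionalExpectation.PullOut
import Mathlib.MeasureTheory.Function.ConditionalExpectation.Real
import Mathlib.MeasureTheory.Function.LpSpace.Complete
import Mathlib.MeasureTheory.Constructions.Polish.StronglyMeasurable
import HarnessLib

/-!
# Stopped martingales in continuous time without the usual conditions

Tools for the proof of Lévy's characterisation of Brownian motion
(`Literature.Probability.Process.levy_characterisation`, `Literature.Probability.Process.ItoCalculus`) for a *raw* filtration
`𝓕` of `ℝ≥0` (neither complete nor right-continuous) and processes with only *almost surely*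
continuous paths. In that setting the value of an adapted process at a stopping time need not be
`𝓕`-measurable (no progressive measurability), so we work throughout with

* `Literature.IsAEMartingale M 𝓕 P`: `M t` is **a.e.** strongly `𝓕 t`-measurable and
  `P[M t | 𝓕 s] = M s` a.e. (`s ≤ t`). Every `MeasureTheory.Martingale` is one; the class is stable
  under a.e. modification, sums, bounded `𝓕 ⊥`-measurable factors and uniformly integrable a.e.
  limits (`IsAEMartingale.of_tendsto_ae`), and it has the test-function form of the martingale
  property `E[H M_t] = E[H M_s]` (`IsAEMartingale.integral_mul_eq`), which is all the Lévy proof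
  uses;
* `Literature.IsOptionalTime 𝓕 ρ` (`{ρ < t} ∈ 𝓕 t`, i.e. a stopping time of `𝓕₊`), the dyadic upper
  approximations `Literature.dyadicCeilTop k ρ ↓ ρ`, which are `𝓕`-stopping times with countable range
  (Le Gall, Prop. 3.8);
* **optional stopping**: a martingale `Y` stopped at a countable-range stopping time is an a.e.
  martingale (`Martingale.isAEMartingale_stoppedProcess_of_countable_range`, from Mathlib's
  discrete optional sampling `stoppedValue_ae_eq_condExp_of_le_const_of_countable_range`), and, if
  `Y` has a.s. continuous paths, so is `Y` stopped at any optional time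
  (`Martingale.isAEMartingale_stoppedProcess`: uniform integrability of the conditional
  expectations and Vitali, exactly as in Le Gall's proof of Thm 3.22);
* `Literature.ratExceed U c = inf {q⁺ : q ∈ ℚ, c < U q⁺}`, an optional time for every adapted `U`
  (Le Gall, Prop. 3.9 (i), along rational times), up to which continuous paths started below `c`
  stay `≤ c` — verbatim the primitive `Literature.Analysis.FunctionSpaces.ratHitting` of `ItoProcessesProofs` (Analysis stack),
  relocated below the Itô stack; the two-sided version is its instance at `|Y|`.

## References

* J.-F. Le Gall, *Brownian Motion, Martingales, and Stochastic Calculus* (2016), Prop. 3.8,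
  Prop. 3.9, Thm 3.22, Cor. 3.23, Cor. 3.24.
* D. Revuz, M. Yor, *Continuous Martingales and Brownian Motion* (3rd ed., 1999), Ch. II,
  Thm (3.2) (optional stopping), Ch. I, Prop. (4.5)–(4.6) (hitting times).
-/

open MeasureTheory Filter
open scoped NNReal ENNReal Topology

namespace Literature.Probability.Process

variable {Ω : Type*} {m : MeasurableSpace Ω}

/-! ### Almost-everywhere martingales -/

section AEMartingale

variable {ι : Type*} [Preorder ι]

/-- `IsAEMartingale M 𝓕 P`: `M` is an **a.e. martingale** for the filtration `𝓕` under `P`: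
every `M t` is integrable and *a.e.* strongly `𝓕 t`-measurable (i.e. a.e. equal to an
`𝓕 t`-measurable function), and `P[M t | 𝓕 s] = M s` a.e. for `s ≤ t`. This is Mathlib's
`MeasureTheory.Martingale` with strong adaptedness weakened to a.e. strong adaptedness; it is the
natural class for stopped values of martingales at optional times when the filtration does not
satisfy the usual conditions (Le Gall works under completeness, where the two notions agree).
Le Gall, *Brownian Motion, Martingales, and Stochastic Calculus* (2016), Def. 3.10 and the
discussion of completions after Def. 3.2. [folklore] -/
structure IsAEMartingale (M : ι → Ω → ℝ) (𝓕 : Filtration ι m) (P : Measure Ω) : Prop where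
  /-- `M t` is a.e. equal to an `𝓕 t`-strongly measurable function. -/
  aestronglyMeasurable : ∀ t, AEStronglyMeasurable[𝓕 t] (M t) P
  /-- The martingale property `E[M t | 𝓕 s] = M s` a.e. for `s ≤ t`. -/
  condExp_ae_eq : ∀ s t, s ≤ t → P[M t | 𝓕 s] =ᵐ[P] M s

namespace IsAEMartingale

variable {M M' : ι → Ω → ℝ} {𝓕 : Filtration ι m} {P : Measure Ω}

/-- A martingale is an a.e. martingale. [folklore] -/
theorem _root_.MeasureTheory.Martingale.isAEMartingale (h : Martingale M 𝓕 P) :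
    IsAEMartingale M 𝓕 P where
  aestronglyMeasurable t := (h.stronglyMeasurable t).aestronglyMeasurable
  condExp_ae_eq _ _ hst := h.condExp_ae_eq hst

/-- An a.e. martingale is integrable at every time (it is a.e. a conditional expectation).
[folklore] -/
theorem integrable (h : IsAEMartingale M 𝓕 P) (t : ι) : Integrable (M t) P :=
  integrable_condExp.congr (h.condExp_ae_eq t t le_rfl)

/-- A modification of an a.e. martingale is an a.e. martingale. [folklore] -/
theorem congr (h : IsAEMartingale M 𝓕 P) (h' : ∀ t, M t =ᵐ[P] M' t) : IsAEMartingale M' 𝓕 P where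
  aestronglyMeasurable t := (h.aestronglyMeasurable t).congr (h' t)
  condExp_ae_eq s t hst :=
    (condExp_congr_ae (h' t).symm).trans ((h.condExp_ae_eq s t hst).trans (h' s))

/-- Sums of a.e. martingales are a.e. martingales. [folklore] -/
theorem add (h : IsAEMartingale M 𝓕 P) (h' : IsAEMartingale M' 𝓕 P) :
    IsAEMartingale (fun t ω ↦ M t ω + M' t ω) 𝓕 P where
  aestronglyMeasurable t := (h.aestronglyMeasurable t).add (h'.aestronglyMeasurable t)
  condExp_ae_eq s t hst := by
    have := (condExp_add (h.integrable t) (h'.integrable t) (𝓕 s)).trans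
      ((h.condExp_ae_eq s t hst).add (h'.condExp_ae_eq s t hst))
    exact this

/-- Differences of a.e. martingales are a.e. martingales. [folklore] -/
theorem sub (h : IsAEMartingale M 𝓕 P) (h' : IsAEMartingale M' 𝓕 P) :
    IsAEMartingale (fun t ω ↦ M t ω - M' t ω) 𝓕 P where
  aestronglyMeasurable t := (h.aestronglyMeasurable t).sub (h'.aestronglyMeasurable t)
  condExp_ae_eq s t hst := by
    have := (condExp_sub (h.integrable t) (h'.integrable t) (𝓕 s)).trans
      ((h.condExp_ae_eq s t hst).sub (h'.condExp_ae_eq s t hst))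
    exact this

/-- Constant multiples of a.e. martingales are a.e. martingales. [folklore] -/
theorem const_mul (h : IsAEMartingale M 𝓕 P) (c : ℝ) :
    IsAEMartingale (fun t ω ↦ c * M t ω) 𝓕 P where
  aestronglyMeasurable t := (h.aestronglyMeasurable t).const_mul c
  condExp_ae_eq s t hst := by
    have h1 := condExp_smul c (M t) (𝓕 s) (μ := P)
    have h2 := h.condExp_ae_eq s t hst
    have h3 : (fun ω ↦ c * M t ω) = c • M t := by ext ω; simp
    rw [h3]
    refine h1.trans ?_
    filter_upwards [h2] with ω hω
    simp [hω]

/-- The defining identity of an a.e. martingale tested against a bounded `𝓕 s`-a.e.-measurable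
weight: `E[H · M t] = E[H · M s]` for `s ≤ t` (pull-out property of conditional expectation).
Le Gall (2016), Def. 3.10 with the characteristic property of `E[· | 𝓕 s]`. [folklore] -/
theorem integral_mul_eq [IsFiniteMeasure P] (h : IsAEMartingale M 𝓕 P) {s t : ι} (hst : s ≤ t)
    {H : Ω → ℝ} (hH : AEStronglyMeasurable[𝓕 s] H P) {C : ℝ} (hC : ∀ᵐ ω ∂P, ‖H ω‖ ≤ C) :
    ∫ ω, H ω * M t ω ∂P = ∫ ω, H ω * M s ω ∂P := by
  have hint : Integrable (M t) P := h.integrable t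
  have h1 := condExp_stronglyMeasurable_mul_of_bound₀ (𝓕.le s) hH hint C hC
  have h2 : (fun ω ↦ H ω * M s ω) =ᵐ[P] H * P[M t | 𝓕 s] := by
    filter_upwards [h.condExp_ae_eq s t hst] with ω hω; simp [hω]
  calc ∫ ω, H ω * M t ω ∂P = ∫ ω, (P[H * M t | 𝓕 s]) ω ∂P := (integral_condExp (𝓕.le s)).symm
  _ = ∫ ω, (H * P[M t | 𝓕 s]) ω ∂P := integral_congr_ae h1
  _ = ∫ ω, H ω * M s ω ∂P := integral_congr_ae h2.symm

/-- Complex-weight version of `IsAEMartingale.integral_mul_eq`: `E[H · M t] = E[H · M s]` for a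
bounded complex `𝓕 s`-a.e.-measurable `H` and `s ≤ t` (real and imaginary parts). [folklore] -/
theorem integral_mul_eq_complex [IsFiniteMeasure P] (h : IsAEMartingale M 𝓕 P) {s t : ι}
    (hst : s ≤ t) {H : Ω → ℂ} (hH : AEStronglyMeasurable[𝓕 s] H P) {C : ℝ}
    (hC : ∀ᵐ ω ∂P, ‖H ω‖ ≤ C) :
    ∫ ω, H ω * M t ω ∂P = ∫ ω, H ω * M s ω ∂P := by
  have hre : AEStronglyMeasurable[𝓕 s] (fun ω ↦ (H ω).re) P :=
    Complex.continuous_re.comp_aestronglyMeasurable hH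
  have him : AEStronglyMeasurable[𝓕 s] (fun ω ↦ (H ω).im) P :=
    Complex.continuous_im.comp_aestronglyMeasurable hH
  have hreC : ∀ᵐ ω ∂P, ‖(H ω).re‖ ≤ C := by
    filter_upwards [hC] with ω hω using (Complex.abs_re_le_norm _).trans hω
  have himC : ∀ᵐ ω ∂P, ‖(H ω).im‖ ≤ C := by
    filter_upwards [hC] with ω hω using (Complex.abs_im_le_norm _).trans hω
  have e1 := h.integral_mul_eq hst hre hreC
  have e2 := h.integral_mul_eq hst him himC
  have hiRe : ∀ r, Integrable (fun ω ↦ (H ω).re * M r ω) P := fun r ↦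
    (h.integrable r).bdd_mul (hre.mono (𝓕.le s)) hreC
  have hiIm : ∀ r, Integrable (fun ω ↦ (H ω).im * M r ω) P := fun r ↦
    (h.integrable r).bdd_mul (him.mono (𝓕.le s)) himC
  have key : ∀ r : ι, ∫ ω, H ω * M r ω ∂P =
      ((∫ ω, (H ω).re * M r ω ∂P : ℝ) : ℂ) + ((∫ ω, (H ω).im * M r ω ∂P : ℝ) : ℂ) * Complex.I := by
    intro r
    have hdecomp : (fun ω ↦ H ω * M r ω) =
        fun ω ↦ (((H ω).re * M r ω : ℝ) : ℂ) + (((H ω).im * M r ω : ℝ) : ℂ) * Complex.I := by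
      ext ω
      conv_lhs => rw [← Complex.re_add_im (H ω)]
      push_cast
      ring
    rw [hdecomp, integral_add _ _, integral_mul_const, integral_complex_ofReal,
      integral_complex_ofReal]
    · exact (hiRe r).ofReal
    · exact (hiIm r).ofReal.mul_const _
  rw [key t, key s, e1, e2]

/-- An integrable, `𝓕`-a.e.-adapted process whose set integrals over `𝓕 s`-measurable sets are
constant in time is an a.e. martingale (characterisation of conditional expectation by set
integrals, Mathlib's `ae_eq_condExp_of_forall_setIntegral_eq`). [folklore] -/
theorem of_setIntegral_eq [IsFiniteMeasure P]
    (hmeas : ∀ t, AEStronglyMeasurable[𝓕 t] (M t) P) (hint : ∀ t, Integrable (M t) P)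
    (h : ∀ s t, s ≤ t → ∀ A, MeasurableSet[𝓕 s] A → ∫ ω in A, M s ω ∂P = ∫ ω in A, M t ω ∂P) :
    IsAEMartingale M 𝓕 P where
  aestronglyMeasurable := hmeas
  condExp_ae_eq s t hst := (ae_eq_condExp_of_forall_setIntegral_eq (𝓕.le s) (hint t)
      (fun _ _ _ ↦ (hint s).integrableOn) (fun A hA _ ↦ h s t hst A hA) (hmeas s)).symm

/-- The set integrals of an a.e. martingale over `𝓕 s`-measurable sets are constant in time:
`∫_A M t = ∫_A M s` for `A ∈ 𝓕 s`, `s ≤ t`. [folklore] -/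
theorem setIntegral_eq [IsFiniteMeasure P] (h : IsAEMartingale M 𝓕 P) {s t : ι} (hst : s ≤ t)
    {A : Set Ω} (hA : MeasurableSet[𝓕 s] A) :
    ∫ ω in A, M t ω ∂P = ∫ ω in A, M s ω ∂P := by
  have h1 := h.integral_mul_eq hst (H := A.indicator fun _ ↦ (1 : ℝ))
    ((stronglyMeasurable_const.indicator hA).aestronglyMeasurable) (C := 1)
    (ae_of_all _ fun ω ↦ by
      by_cases hω : ω ∈ A <;> simp [hω])
  have hA' : MeasurableSet A := 𝓕.le s A hA
  have hind : ∀ r, (fun ω ↦ A.indicator (fun _ ↦ (1 : ℝ)) ω * M r ω) = A.indicator (M r) := by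
    intro r; ext ω; by_cases hω : ω ∈ A <;> simp [hω]
  change ∫ ω, (fun ω ↦ A.indicator (fun _ ↦ (1 : ℝ)) ω * M t ω) ω ∂P =
    ∫ ω, (fun ω ↦ A.indicator (fun _ ↦ (1 : ℝ)) ω * M s ω) ω ∂P at h1
  rwa [hind, hind, integral_indicator hA', integral_indicator hA'] at h1

/-- An a.e. limit (a.e. for the ambient measure) of functions that are a.e. strongly measurable
with respect to a sub-σ-algebra `m'` is a.e. strongly measurable with respect to `m'` (take the
pointwise `limUnder` of `m'`-measurable representatives). [folklore] -/
theorem _root_.Literature.Probability.Process.aestronglyMeasurable_of_tendsto_ae' {m' : MeasurableSpace Ω} {μ : Measure[m] Ω}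
    {f : ℕ → Ω → ℝ} {g : Ω → ℝ} (hf : ∀ k, AEStronglyMeasurable[m'] (f k) μ)
    (hlim : ∀ᵐ ω ∂μ, Tendsto (f · ω) atTop (𝓝 (g ω))) : AEStronglyMeasurable[m'] g μ := by
  refine ⟨fun ω ↦ limUnder atTop (fun k ↦ (hf k).mk (f k) ω),
    StronglyMeasurable.limUnder (fun k ↦ (hf k).stronglyMeasurable_mk), ?_⟩
  have hall : ∀ᵐ ω ∂μ, ∀ k, f k ω = (hf k).mk (f k) ω := ae_all_iff.2 fun k ↦ (hf k).ae_eq_mk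
  filter_upwards [hall, hlim] with ω hω hω'
  have : Tendsto (fun k ↦ (hf k).mk (f k) ω) atTop (𝓝 (g ω)) := by
    simpa [← hω] using hω'
  exact (this.limUnder_eq).symm

/-- **Closure under uniformly integrable limits**: if a.e. martingales `Mk k` converge a.e. to
`M` at every time and `(Mk k t)_k` is uniformly integrable for every `t`, then `M` is an a.e.
martingale (Vitali: the convergence holds in `L¹`, so set integrals pass to the limit).
Le Gall (2016), proof of Thm 3.22 (the `L¹`-convergence step). [folklore] -/
theorem of_tendsto_ae [IsFiniteMeasure P] {Mk : ℕ → ι → Ω → ℝ}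
    (hMk : ∀ k, IsAEMartingale (Mk k) 𝓕 P)
    (hui : ∀ t, UniformIntegrable (fun k ↦ Mk k t) 1 P)
    (hlim : ∀ t, ∀ᵐ ω ∂P, Tendsto (fun k ↦ Mk k t ω) atTop (𝓝 (M t ω))) :
    IsAEMartingale M 𝓕 P := by
  have hmeas : ∀ t, AEStronglyMeasurable[𝓕 t] (M t) P := fun t ↦
    aestronglyMeasurable_of_tendsto_ae' (fun k ↦ (hMk k).aestronglyMeasurable t) (hlim t)
  have hmeas0 : ∀ t, AEStronglyMeasurable (M t) P := fun t ↦ (hmeas t).mono (𝓕.le t)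
  have hmem : ∀ t, MemLp (M t) 1 P := by
    intro t
    obtain ⟨C, hC⟩ := (hui t).2.2
    refine ⟨hmeas0 t, ?_⟩
    have h1 : eLpNorm (M t) 1 P ≤ atTop.liminf fun k ↦ eLpNorm (Mk k t) 1 P :=
      Lp.eLpNorm_lim_le_liminf_eLpNorm
        (fun k ↦ ((hMk k).integrable t).aestronglyMeasurable) _ (hlim t)
    have h2 : atTop.liminf (fun k ↦ eLpNorm (Mk k t) 1 P) ≤ C :=
      liminf_le_of_frequently_le' (Frequently.of_forall fun k ↦ hC k)
    exact lt_of_le_of_lt (h1.trans h2) ENNReal.coe_lt_top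
  have hint : ∀ t, Integrable (M t) P := fun t ↦ memLp_one_iff_integrable.1 (hmem t)
  have hL1 : ∀ t, Tendsto (fun k ↦ eLpNorm (Mk k t - M t) 1 P) atTop (𝓝 0) := fun t ↦
    tendsto_Lp_finite_of_tendsto_ae le_rfl ENNReal.one_ne_top
      (fun k ↦ ((hMk k).integrable t).aestronglyMeasurable) (hmem t) (hui t).2.1 (hlim t)
  have hset : ∀ t (A : Set Ω),
      Tendsto (fun k ↦ ∫ ω in A, Mk k t ω ∂P) atTop (𝓝 (∫ ω in A, M t ω ∂P)) := fun t A ↦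
    tendsto_setIntegral_of_L1' (M t) (hmeas0 t)
      (Eventually.of_forall fun k ↦ (hMk k).integrable t) (hL1 t) A
  refine of_setIntegral_eq hmeas hint fun s t hst A hA ↦ ?_
  have : (fun k ↦ ∫ ω in A, Mk k s ω ∂P) = fun k ↦ ∫ ω in A, Mk k t ω ∂P :=
    funext fun k ↦ ((hMk k).setIntegral_eq hst hA).symm
  exact tendsto_nhds_unique (hset s A) (this ▸ hset t A)

/-- Multiplying an a.e. martingale by a bounded weight measurable for the initial σ-algebra
`𝓕 ⊥` gives an a.e. martingale (pull-out property; used for the factor `𝟙_{0 < τ}` in Mathlib's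
localisation convention `(𝟙_{⊥ < τ} X)^τ`). [folklore] -/
theorem mul_of_bot {ι : Type*} [Preorder ι] [OrderBot ι] {M : ι → Ω → ℝ} {𝓕 : Filtration ι m}
    [IsFiniteMeasure P] (h : IsAEMartingale M 𝓕 P) {G : Ω → ℝ}
    (hG : StronglyMeasurable[𝓕 ⊥] G) {C : ℝ} (hC : ∀ ω, ‖G ω‖ ≤ C) :
    IsAEMartingale (fun t ω ↦ G ω * M t ω) 𝓕 P where
  aestronglyMeasurable t :=
    ((hG.mono (𝓕.mono bot_le)).aestronglyMeasurable).mul (h.aestronglyMeasurable t)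
  condExp_ae_eq s t hst := by
    have hGs : StronglyMeasurable[𝓕 s] G := hG.mono (𝓕.mono bot_le)
    have h1 := condExp_stronglyMeasurable_mul_of_bound (𝓕.le s) hGs (h.integrable t) C
      (ae_of_all _ hC)
    refine h1.trans ?_
    filter_upwards [h.condExp_ae_eq s t hst] with ω hω
    simp [hω]

end IsAEMartingale

end AEMartingale

/-! ### Dyadic upper approximation of random times (`ι = ℝ≥0`) -/

section Dyadic

/-- The `k`-th **dyadic upper approximation** of `r : ℝ≥0`: the smallest point of the grid
`2⁻ᵏ ℕ` which is *strictly* larger than `r`, i.e. `(⌊2ᵏ r⌋ + 1) 2⁻ᵏ` (Le Gall's `T_n` takes the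
smallest grid point `≥ T`; the strict version used here only needs `{ρ < t} ∈ 𝓕 t`).
Le Gall, *Brownian Motion, Martingales, and Stochastic Calculus* (2016), Prop. 3.8. [folklore] -/
noncomputable def dyadicCeil (k : ℕ) (r : ℝ≥0) : ℝ≥0 :=
  ((⌊r * 2 ^ k⌋₊ + 1 : ℕ) : ℝ≥0) / 2 ^ k

/-- `r < dyadicCeil k r`. [folklore] -/
theorem lt_dyadicCeil (k : ℕ) (r : ℝ≥0) : r < dyadicCeil k r := by
  rw [dyadicCeil, lt_div_iff₀ (by positivity)]
  exact_mod_cast Nat.lt_floor_add_one (r * 2 ^ k)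

/-- `dyadicCeil k r ≤ r + 2⁻ᵏ`. [folklore] -/
theorem dyadicCeil_le (k : ℕ) (r : ℝ≥0) : dyadicCeil k r ≤ r + 1 / 2 ^ k := by
  rw [dyadicCeil, div_le_iff₀ (by positivity), add_mul, div_mul_cancel₀ _ (by positivity)]
  push_cast
  gcongr
  exact Nat.floor_le (by positivity)

/-- `dyadicCeil k r ≤ t` iff `r` lies strictly below the largest grid point `⌊2ᵏ t⌋ 2⁻ᵏ ≤ t`
(the key to the stopping-time property of dyadic approximants). [folklore] -/
theorem dyadicCeil_le_iff (k : ℕ) (r t : ℝ≥0) :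
    dyadicCeil k r ≤ t ↔ r < ((⌊t * 2 ^ k⌋₊ : ℕ) : ℝ≥0) / 2 ^ k := by
  rw [dyadicCeil, div_le_iff₀ (by positivity), lt_div_iff₀ (by positivity)]
  constructor
  · intro h
    have h' : ⌊r * 2 ^ k⌋₊ + 1 ≤ ⌊t * 2 ^ k⌋₊ := Nat.le_floor (by exact_mod_cast h)
    calc r * 2 ^ k < (⌊r * 2 ^ k⌋₊ + 1 : ℕ) := by exact_mod_cast Nat.lt_floor_add_one _
    _ ≤ (⌊t * 2 ^ k⌋₊ : ℕ) := by exact_mod_cast h'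
  · intro h
    have h' : ⌊r * 2 ^ k⌋₊ < ⌊t * 2 ^ k⌋₊ := (Nat.floor_lt (by positivity)).2 ?_
    · calc ((⌊r * 2 ^ k⌋₊ + 1 : ℕ) : ℝ≥0) ≤ (⌊t * 2 ^ k⌋₊ : ℕ) := by exact_mod_cast h'
      _ ≤ t * 2 ^ k := Nat.floor_le (by positivity)
    · exact_mod_cast h

/-- The grid point `⌊2ᵏ t⌋ 2⁻ᵏ` is `≤ t`. [folklore] -/
theorem floorGrid_le (k : ℕ) (t : ℝ≥0) : ((⌊t * 2 ^ k⌋₊ : ℕ) : ℝ≥0) / 2 ^ k ≤ t := by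
  rw [div_le_iff₀ (by positivity)]
  exact Nat.floor_le (by positivity)

/-- `dyadicCeil k r → r` as `k → ∞`. Le Gall (2016), Prop. 3.8 (`T_n ↓ T`). [folklore] -/
theorem tendsto_dyadicCeil (r : ℝ≥0) : Tendsto (fun k ↦ dyadicCeil k r) atTop (𝓝 r) := by
  have h1 : Tendsto (fun k : ℕ ↦ r + 1 / 2 ^ k) atTop (𝓝 r) := by
    have : Tendsto (fun k : ℕ ↦ (1 : ℝ≥0) / 2 ^ k) atTop (𝓝 0) := by
      simp_rw [one_div, ← inv_pow]
      exact tendsto_pow_atTop_nhds_zero_of_lt_one (by positivity) (by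
        rw [inv_lt_one_iff₀]; exact Or.inr one_lt_two)
    simpa using tendsto_const_nhds.add this
  exact tendsto_of_tendsto_of_tendsto_of_le_of_le tendsto_const_nhds h1
    (fun k ↦ (lt_dyadicCeil k r).le) (fun k ↦ dyadicCeil_le k r)

/-- Dyadic upper approximation on `WithTop ℝ≥0` (`⊤ ↦ ⊤`), the form applied to random times.
Le Gall, *Brownian Motion, Martingales, and Stochastic Calculus* (2016), Prop. 3.8. [folklore] -/
noncomputable def dyadicCeilTop (k : ℕ) : WithTop ℝ≥0 → WithTop ℝ≥0 :=
  WithTop.map (dyadicCeil k)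

/-- `dyadicCeilTop k ⊤ = ⊤`. [folklore] -/
@[simp] theorem dyadicCeilTop_top (k : ℕ) : dyadicCeilTop k ⊤ = ⊤ := rfl

/-- `dyadicCeilTop k ↑r = ↑(dyadicCeil k r)`. [folklore] -/
@[simp] theorem dyadicCeilTop_coe (k : ℕ) (r : ℝ≥0) :
    dyadicCeilTop k (r : WithTop ℝ≥0) = (dyadicCeil k r : ℝ≥0) := rfl

/-- `x ≤ dyadicCeilTop k x`. [folklore] -/
theorem le_dyadicCeilTop (k : ℕ) (x : WithTop ℝ≥0) : x ≤ dyadicCeilTop k x := by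
  induction x using WithTop.recTopCoe with
  | top => simp
  | coe r => rw [dyadicCeilTop_coe, WithTop.coe_le_coe]; exact (lt_dyadicCeil k r).le

/-- `dyadicCeilTop k x ≤ t` iff `x < ⌊2ᵏ t⌋ 2⁻ᵏ`. [folklore] -/
theorem dyadicCeilTop_le_coe_iff (k : ℕ) (x : WithTop ℝ≥0) (t : ℝ≥0) :
    dyadicCeilTop k x ≤ (t : WithTop ℝ≥0) ↔
      x < ((((⌊t * 2 ^ k⌋₊ : ℕ) : ℝ≥0) / 2 ^ k : ℝ≥0) : WithTop ℝ≥0) := by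
  induction x using WithTop.recTopCoe with
  | top => simp only [dyadicCeilTop_top, top_le_iff, WithTop.coe_ne_top, not_top_lt]
  | coe r => rw [dyadicCeilTop_coe, WithTop.coe_le_coe, WithTop.coe_lt_coe, dyadicCeil_le_iff]

/-- `dyadicCeilTop k` has countable range (`⊤` and the grid `2⁻ᵏ ℕ`). [folklore] -/
theorem countable_range_dyadicCeilTop (k : ℕ) : (Set.range (dyadicCeilTop k)).Countable := by
  have : Set.range (dyadicCeilTop k) ⊆
      insert ⊤ (Set.range fun n : ℕ ↦ (((n : ℝ≥0) / 2 ^ k : ℝ≥0) : WithTop ℝ≥0)) := by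
    rintro _ ⟨x, rfl⟩
    induction x using WithTop.recTopCoe with
    | top => simp
    | coe r => exact Set.mem_insert_of_mem _ ⟨⌊r * 2 ^ k⌋₊ + 1, by
        rw [dyadicCeilTop_coe, dyadicCeil]⟩
  exact ((Set.countable_range _).insert _).mono this

/-- The capped times `t ∧ dyadicCeilTop k x` converge to `t ∧ x` (read in `ℝ≥0`). [folklore] -/
theorem tendsto_untopA_min_dyadicCeilTop (t : ℝ≥0) (x : WithTop ℝ≥0) :
    Tendsto (fun k ↦ (min (t : WithTop ℝ≥0) (dyadicCeilTop k x)).untopA) atTop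
      (𝓝 (min (t : WithTop ℝ≥0) x).untopA) := by
  induction x using WithTop.recTopCoe with
  | top => simp only [dyadicCeilTop_top, le_top, min_eq_left]; exact tendsto_const_nhds
  | coe r =>
    have h : ∀ k, (min (t : WithTop ℝ≥0) (dyadicCeilTop k r)).untopA = min t (dyadicCeil k r) := by
      intro k
      rw [dyadicCeilTop_coe, ← WithTop.coe_min, WithTop.untopA, WithTop.untopD_coe]
    have h' : (min (t : WithTop ℝ≥0) r).untopA = min t r := by
      rw [← WithTop.coe_min, WithTop.untopA, WithTop.untopD_coe]
    simp_rw [h, h']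
    exact (continuous_min.tendsto (t, r)).comp (tendsto_const_nhds.prodMk_nhds (tendsto_dyadicCeil r))

end Dyadic

/-! ### Optional times and stopped martingales -/

section Optional

variable {𝓕 : Filtration ℝ≥0 m} {P : Measure Ω}

/-- `ρ : Ω → WithTop ℝ≥0` is an **optional time** of the filtration `𝓕` (equivalently, a
stopping time of the right-continuous regularisation `𝓕₊`) if `{ρ < t} ∈ 𝓕 t` for every `t`.
Le Gall, *Brownian Motion, Martingales, and Stochastic Calculus* (2016), Prop. 3.9 (i) and the
remark before Prop. 3.6 (stopping times of `(𝓕ₜ₊)`); Revuz–Yor (1999), Ch. I, Def. (4.1) ff.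
[folklore] -/
def IsOptionalTime (𝓕 : Filtration ℝ≥0 m) (ρ : Ω → WithTop ℝ≥0) : Prop :=
  ∀ t : ℝ≥0, MeasurableSet[𝓕 t] {ω | ρ ω < t}

/-- A stopping time is an optional time. [folklore] -/
theorem _root_.MeasureTheory.IsStoppingTime.isOptionalTime {τ : Ω → WithTop ℝ≥0}
    (hτ : IsStoppingTime 𝓕 τ) : IsOptionalTime 𝓕 τ :=
  fun t ↦ hτ.measurableSet_lt t

/-- The minimum of two optional times is an optional time. [folklore] -/
theorem IsOptionalTime.min {ρ σ : Ω → WithTop ℝ≥0} (hρ : IsOptionalTime 𝓕 ρ)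
    (hσ : IsOptionalTime 𝓕 σ) : IsOptionalTime 𝓕 fun ω ↦ min (ρ ω) (σ ω) := by
  intro t
  have : {ω | Min.min (ρ ω) (σ ω) < t} = {ω | ρ ω < t} ∪ {ω | σ ω < t} := by
    ext ω; simp
  rw [this]
  exact (hρ t).union (hσ t)

/-- The dyadic upper approximations of an optional time are (genuine) stopping times of `𝓕`:
`{dyadicCeilTop k ρ ≤ t} = {ρ < ⌊2ᵏ t⌋ 2⁻ᵏ} ∈ 𝓕_{⌊2ᵏ t⌋ 2⁻ᵏ} ⊆ 𝓕 t`.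
Le Gall, *Brownian Motion, Martingales, and Stochastic Calculus* (2016), Prop. 3.8. [folklore] -/
theorem IsOptionalTime.isStoppingTime_dyadicCeilTop {ρ : Ω → WithTop ℝ≥0}
    (hρ : IsOptionalTime 𝓕 ρ) (k : ℕ) : IsStoppingTime 𝓕 fun ω ↦ dyadicCeilTop k (ρ ω) := by
  intro t
  have : {ω | dyadicCeilTop k (ρ ω) ≤ (t : WithTop ℝ≥0)} =
      {ω | ρ ω < ((((⌊t * 2 ^ k⌋₊ : ℕ) : ℝ≥0) / 2 ^ k : ℝ≥0) : WithTop ℝ≥0)} := by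
    ext ω; exact dyadicCeilTop_le_coe_iff k (ρ ω) t
  rw [this]
  exact 𝓕.mono (floorGrid_le k t) _ (hρ _)

/-- The value of a strongly adapted process at a bounded stopping time with countable range is
strongly measurable with respect to the σ-algebra of the bound (no progressive measurability is
needed in the countable case). Le Gall (2016), Thm 3.7 (countable case). [folklore] -/
theorem stronglyMeasurable_stoppedValue_of_countable_range {Y : ℝ≥0 → Ω → ℝ}
    (hY : StronglyAdapted 𝓕 Y) {κ : Ω → WithTop ℝ≥0} (hκ : IsStoppingTime 𝓕 κ)
    (hcount : (Set.range κ).Countable) {t : ℝ≥0} (hle : ∀ ω, κ ω ≤ t) :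
    StronglyMeasurable[𝓕 t] (stoppedValue Y κ) := by
  refine Measurable.stronglyMeasurable ?_
  intro B hB
  have hset : stoppedValue Y κ ⁻¹' B =
      ⋃ v ∈ Set.range κ, {ω | κ ω = v} ∩ (Y v.untopA) ⁻¹' B := by
    ext ω
    simp only [Set.mem_preimage, Set.mem_iUnion, Set.mem_inter_iff, Set.mem_setOf_eq,
      exists_prop]
    constructor
    · intro h; exact ⟨κ ω, Set.mem_range_self ω, rfl, h⟩
    · rintro ⟨v, -, hv, h⟩
      change Y (κ ω).untopA ω ∈ B
      rwa [hv]
  rw [hset]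
  refine MeasurableSet.biUnion hcount fun v hv ↦ ?_
  obtain ⟨ω₀, rfl⟩ := hv
  have hne : κ ω₀ ≠ ⊤ := ne_top_of_le_ne_top WithTop.coe_ne_top (hle ω₀)
  obtain ⟨i, hi⟩ := WithTop.ne_top_iff_exists.1 hne
  rw [← hi]
  have hit : i ≤ t := by have := hle ω₀; rw [← hi] at this; exact_mod_cast this
  refine MeasurableSet.inter (𝓕.mono hit _ (hκ.measurableSet_eq i)) ?_
  rw [WithTop.untopA, WithTop.untopD_coe]
  exact 𝓕.mono hit _ ((hY i).measurable hB)

variable [IsFiniteMeasure P]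

/-- **Optional stopping, countable case.** A martingale stopped at a stopping time `κ` with
countable range is an a.e. martingale (no path regularity needed): `Y_{r ∧ κ} = E[Y r | 𝓕_{r ∧ κ}]`
by discrete optional sampling (Mathlib's
`Martingale.stoppedValue_ae_eq_condExp_of_le_const_of_countable_range`), and for `A ∈ 𝓕 s` the
set `A ∩ {s < κ}` belongs to `𝓕_{r ∧ κ}` for every `r ≥ s`.
Le Gall, *Brownian Motion, Martingales, and Stochastic Calculus* (2016), Cor. 3.24 (i) (discrete
step of the proof of Thm 3.22). [cite: Legall2016, Thm 3.22 and Cor. 3.24] -/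
theorem _root_.MeasureTheory.Martingale.isAEMartingale_stoppedProcess_of_countable_range
    {Y : ℝ≥0 → Ω → ℝ} (hY : Martingale Y 𝓕 P) {κ : Ω → WithTop ℝ≥0} (hκ : IsStoppingTime 𝓕 κ)
    (hcount : (Set.range κ).Countable) : IsAEMartingale (stoppedProcess Y κ) 𝓕 P := by
  have hκr : ∀ r : ℝ≥0, IsStoppingTime 𝓕 (fun ω ↦ min (r : WithTop ℝ≥0) (κ ω)) := fun r ↦
    (isStoppingTime_const 𝓕 r).min hκ
  have hle : ∀ (r : ℝ≥0) (ω : Ω), min (r : WithTop ℝ≥0) (κ ω) ≤ r := fun r ω ↦ min_le_left _ _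
  have hcount' : ∀ r : ℝ≥0, (Set.range fun ω ↦ min (r : WithTop ℝ≥0) (κ ω)).Countable := by
    intro r
    refine (hcount.insert (r : WithTop ℝ≥0)).mono ?_
    rintro _ ⟨ω, rfl⟩
    change min (r : WithTop ℝ≥0) (κ ω) ∈ _
    rcases min_choice (r : WithTop ℝ≥0) (κ ω) with h | h
    · rw [h]; exact Set.mem_insert _ _
    · rw [h]; exact Set.mem_insert_of_mem _ (Set.mem_range_self ω)
  have hmeas : ∀ r : ℝ≥0, StronglyMeasurable[𝓕 r] (stoppedProcess Y κ r) := fun r ↦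
    stronglyMeasurable_stoppedValue_of_countable_range hY.stronglyAdapted (hκr r) (hcount' r)
      (hle r)
  have hopt : ∀ r : ℝ≥0, stoppedProcess Y κ r =ᵐ[P] P[Y r | (hκr r).measurableSpace] := fun r ↦
    hY.stoppedValue_ae_eq_condExp_of_le_const_of_countable_range (hκr r) (hle r) (hcount' r)
  have hint : ∀ r, Integrable (stoppedProcess Y κ r) P := fun r ↦
    integrable_condExp.congr (hopt r).symm
  refine IsAEMartingale.of_setIntegral_eq (fun r ↦ (hmeas r).aestronglyMeasurable) hint ?_
  intro s t hst A hA
  set A₁ := A ∩ {ω | κ ω ≤ s} with hA₁_def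
  set A₂ := A ∩ {ω | (s : WithTop ℝ≥0) < κ ω} with hA₂_def
  have hA0 : MeasurableSet A := 𝓕.le s _ hA
  have hks : MeasurableSet[𝓕 s] {ω | κ ω ≤ s} := hκ.measurableSet_le s
  have hgs : MeasurableSet[𝓕 s] {ω | (s : WithTop ℝ≥0) < κ ω} := hκ.measurableSet_gt s
  have hA₁ : MeasurableSet A₁ := hA0.inter (𝓕.le s _ hks)
  have hA₂s : MeasurableSet[𝓕 s] A₂ := hA.inter hgs
  have hA₂ : MeasurableSet A₂ := 𝓕.le s _ hA₂s
  have hdisj : Disjoint A₁ A₂ := by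
    rw [Set.disjoint_left]
    rintro ω ⟨-, h1⟩ ⟨-, h2⟩
    rw [Set.mem_setOf_eq] at h1 h2
    exact absurd (lt_of_lt_of_le h2 h1) (lt_irrefl _)
  have hunion : A = A₁ ∪ A₂ := by
    ext ω
    simp only [hA₁_def, hA₂_def, Set.mem_union, Set.mem_inter_iff, Set.mem_setOf_eq]
    constructor
    · intro h
      rcases le_or_gt (κ ω) s with h' | h'
      exacts [Or.inl ⟨h, h'⟩, Or.inr ⟨h, h'⟩]
    · rintro (⟨h, -⟩ | ⟨h, -⟩) <;> exact h
  have hA₂κ : ∀ r : ℝ≥0, s ≤ r → MeasurableSet[(hκr r).measurableSpace] A₂ := by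
    intro r hsr
    refine (IsStoppingTime.measurableSet _ _).2 ⟨hA₂, fun i ↦ ?_⟩
    rcases le_or_gt s i with hsi | his
    · exact (𝓕.mono hsi _ hA₂s).inter ((hκr r).measurableSet_le i)
    · have : A₂ ∩ {ω | min (r : WithTop ℝ≥0) (κ ω) ≤ i} = ∅ := by
        ext ω
        simp only [hA₂_def, Set.mem_inter_iff, Set.mem_setOf_eq, Set.mem_empty_iff_false,
          iff_false, not_and, min_le_iff, not_or, not_le]
        intro hω
        refine ⟨by exact_mod_cast his.trans_le hsr, ?_⟩
        exact lt_trans (by exact_mod_cast his) hω.2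
      rw [this]
      exact @MeasurableSet.empty _ (𝓕 i)
  have split : ∀ r : ℝ≥0, ∫ ω in A, stoppedProcess Y κ r ω ∂P =
      ∫ ω in A₁, stoppedProcess Y κ r ω ∂P + ∫ ω in A₂, stoppedProcess Y κ r ω ∂P := by
    intro r
    rw [hunion]
    exact setIntegral_union hdisj hA₂ (hint r).integrableOn (hint r).integrableOn
  have part1 : ∫ ω in A₁, stoppedProcess Y κ s ω ∂P = ∫ ω in A₁, stoppedProcess Y κ t ω ∂P := by
    refine setIntegral_congr_fun hA₁ fun ω hω ↦ ?_
    have h1 : κ ω ≤ (s : WithTop ℝ≥0) := hω.2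
    have h2 : κ ω ≤ (t : WithTop ℝ≥0) := h1.trans (by exact_mod_cast hst)
    simp only [stoppedProcess, min_eq_right h1, min_eq_right h2]
  have part2 : ∀ r : ℝ≥0, s ≤ r →
      ∫ ω in A₂, stoppedProcess Y κ r ω ∂P = ∫ ω in A₂, Y r ω ∂P := by
    intro r hsr
    rw [setIntegral_congr_ae hA₂ ((hopt r).mono fun ω h _ ↦ h)]
    exact setIntegral_condExp (hκr r).measurableSpace_le (hY.integrable r) (hA₂κ r hsr)
  rw [split, split, part1, part2 s le_rfl, part2 t hst, hY.setIntegral_eq hst hA₂s]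

/-- **Optional stopping for a.s.-continuous martingales (raw filtration).** A martingale with
a.s. continuous paths stopped at an optional time `ρ` is an a.e. martingale: stop at the dyadic
stopping times `dyadicCeilTop k ρ ↓ ρ` (countable case), and pass to the limit using path
continuity and the uniform integrability of `(E[Y t | 𝓕_{t ∧ ρₖ}])ₖ` (Vitali).
Le Gall, *Brownian Motion, Martingales, and Stochastic Calculus* (2016), Thm 3.22 (proof) and
Cor. 3.24 (i). [cite: Legall2016, Thm 3.22 and Cor. 3.24] -/
theorem _root_.MeasureTheory.Martingale.isAEMartingale_stoppedProcess {Y : ℝ≥0 → Ω → ℝ}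
    (hY : Martingale Y 𝓕 P) (hcont : ∀ᵐ ω ∂P, Continuous (Y · ω)) {ρ : Ω → WithTop ℝ≥0}
    (hρ : IsOptionalTime 𝓕 ρ) : IsAEMartingale (stoppedProcess Y ρ) 𝓕 P := by
  set ρk : ℕ → Ω → WithTop ℝ≥0 := fun k ω ↦ dyadicCeilTop k (ρ ω) with hρk_def
  have hρk : ∀ k, IsStoppingTime 𝓕 (ρk k) := fun k ↦ hρ.isStoppingTime_dyadicCeilTop k
  have hcountk : ∀ k, (Set.range (ρk k)).Countable := fun k ↦
    (countable_range_dyadicCeilTop k).mono (by rintro _ ⟨ω, rfl⟩; exact ⟨ρ ω, rfl⟩)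
  have hMk : ∀ k, IsAEMartingale (stoppedProcess Y (ρk k)) 𝓕 P := fun k ↦
    hY.isAEMartingale_stoppedProcess_of_countable_range (hρk k) (hcountk k)
  refine IsAEMartingale.of_tendsto_ae hMk (fun t ↦ ?_) (fun t ↦ ?_)
  · -- uniform integrability: the stopped values are conditional expectations of `Y t`
    have hκ : ∀ k, IsStoppingTime 𝓕 (fun ω ↦ min (t : WithTop ℝ≥0) (ρk k ω)) := fun k ↦
      (isStoppingTime_const 𝓕 t).min (hρk k)
    have hle : ∀ k (ω : Ω), min (t : WithTop ℝ≥0) (ρk k ω) ≤ t := fun k ω ↦ min_le_left _ _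
    have hcount' : ∀ k, (Set.range fun ω ↦ min (t : WithTop ℝ≥0) (ρk k ω)).Countable := by
      intro k
      refine ((hcountk k).insert (t : WithTop ℝ≥0)).mono ?_
      rintro _ ⟨ω, rfl⟩
      change min (t : WithTop ℝ≥0) (ρk k ω) ∈ _
      rcases min_choice (t : WithTop ℝ≥0) (ρk k ω) with h | h
      · rw [h]; exact Set.mem_insert _ _
      · rw [h]; exact Set.mem_insert_of_mem _ (Set.mem_range_self ω)
    have hopt : ∀ k, stoppedProcess Y (ρk k) t =ᵐ[P] P[Y t | (hκ k).measurableSpace] := fun k ↦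
      hY.stoppedValue_ae_eq_condExp_of_le_const_of_countable_range (hκ k) (hle k) (hcount' k)
    have hui := (hY.integrable t).uniformIntegrable_condExp (fun k ↦ (hκ k).measurableSpace_le)
    exact hui.ae_eq fun k ↦ (hopt k).symm
  · filter_upwards [hcont] with ω hω
    have h1 := tendsto_untopA_min_dyadicCeilTop t (ρ ω)
    exact (hω.tendsto _).comp h1

end Optional

/-! ### Optional times: first rational time above a level -/

section RatExceed

variable {𝓕 : Filtration ℝ≥0 m}

/-- `ratExceed U c ω`: the **first nonnegative rational time** (rationals `q`, read as
`q⁺ = max(q, 0)`) at which the real process `U` strictly exceeds the level `c`, as a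
`WithTop ℝ≥0`-valued random time (`⊤` if never). For an adapted `U` this is an *optional* time of
the raw filtration (`{ratExceed U c < t} ∈ 𝓕 t`), in general not a stopping time; along
continuous paths starting at or below `c` the process stays `≤ c` up to and including this time.
This is *verbatim* the primitive `Literature.Analysis.FunctionSpaces.ratHitting` of
`Literature.Analysis.FunctionSpaces.ItoProcessesProofs` (same signature and body), placed here,
below the Itô/SDE stack, as its intended low-level home (that file cannot be imported from this
one; a librarian may redirect the higher copy to this definition). Two-sided exceedance of a level
`N` by `|Y|` is the instance `ratExceed (fun t ω ↦ |Y t ω|) N`.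
Le Gall, *Brownian Motion, Martingales, and Stochastic Calculus* (2016), Prop. 3.9 (i)
(`{T_O < t} = ⋃_{s ∈ [0,t) ∩ ℚ} {X_s ∈ O}`). [folklore] -/
noncomputable def ratExceed (U : ℝ≥0 → Ω → ℝ) (c : ℝ) : Ω → WithTop ℝ≥0 :=
  fun ω ↦ ⨅ (q : ℚ) (_ : c < U (q : ℝ).toNNReal ω), (((q : ℝ).toNNReal : ℝ≥0) : WithTop ℝ≥0)

variable {U : ℝ≥0 → Ω → ℝ} {c : ℝ}

/-- `ratExceed U c ω < t` iff some rational time `q⁺ < t` has `U q⁺ ω > c`. [folklore] -/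
theorem ratExceed_lt_iff {ω : Ω} {t : WithTop ℝ≥0} :
    ratExceed U c ω < t ↔ ∃ q : ℚ, c < U (q : ℝ).toNNReal ω ∧
      (((q : ℝ).toNNReal : ℝ≥0) : WithTop ℝ≥0) < t := by
  simp only [ratExceed, iInf_lt_iff, exists_prop]

/-- A rational time at which `U` exceeds `c` bounds `ratExceed U c` from above. [folklore] -/
theorem ratExceed_le {ω : Ω} {q : ℚ} (hq : c < U (q : ℝ).toNNReal ω) :
    ratExceed U c ω ≤ (((q : ℝ).toNNReal : ℝ≥0) : WithTop ℝ≥0) :=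
  (iInf_le _ q).trans (iInf_le _ hq)

/-- If `U q⁺ ω ≤ c` at all rational times `q⁺ ≤ T` then `T ≤ ratExceed U c ω`. [folklore] -/
theorem le_ratExceed_of_forall {ω : Ω} {T : ℝ≥0}
    (h : ∀ q : ℚ, (q : ℝ).toNNReal ≤ T → U (q : ℝ).toNNReal ω ≤ c) :
    (T : WithTop ℝ≥0) ≤ ratExceed U c ω := by
  refine le_iInf₂ fun q hq ↦ ?_
  by_contra hlt
  rw [not_le, WithTop.coe_lt_coe] at hlt
  exact absurd (h q hlt.le) (not_le.2 hq)

/-- `ratExceed U c` is an **optional time** of any raw filtration to which `U` is adapted: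
`{ratExceed U c < t} = ⋃_{q ∈ ℚ, q⁺ < t} {c < U q⁺} ∈ 𝓕 t`.
Le Gall, *Brownian Motion, Martingales, and Stochastic Calculus* (2016), Prop. 3.9 (i).
[cite: Legall2016, Prop. 3.9] -/
theorem isOptionalTime_ratExceed (hU : Adapted 𝓕 U) (c : ℝ) :
    IsOptionalTime 𝓕 (ratExceed U c) := by
  intro t
  have hset : {ω | ratExceed U c ω < t} = ⋃ q : ℚ, ⋃ (_ : ((q : ℝ).toNNReal : ℝ≥0) < t),
      {ω | c < U (q : ℝ).toNNReal ω} := by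
    ext ω
    simp only [Set.mem_setOf_eq, ratExceed_lt_iff, WithTop.coe_lt_coe, Set.mem_iUnion,
      exists_prop, and_comm]
  rw [hset]
  refine MeasurableSet.iUnion fun q ↦ MeasurableSet.iUnion fun hq ↦ ?_
  exact measurableSet_lt (measurable_const (a := c)) ((hU _).mono (𝓕.mono hq.le) le_rfl)

/-- Along a continuous path starting at or below the level, the process stays `≤ c` up to and
including the optional time `ratExceed U c` (if `c < U s` then by continuity `c < U q⁺` at a
rational `q⁺ < s`). [folklore] -/
theorem le_of_le_ratExceed {ω : Ω} (hc : Continuous (U · ω)) (h0 : U 0 ω ≤ c) {s : ℝ≥0}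
    (hs : (s : WithTop ℝ≥0) ≤ ratExceed U c ω) : U s ω ≤ c := by
  by_contra hlt
  rw [not_le] at hlt
  rcases eq_or_ne s 0 with rfl | hs0
  · exact (not_le.2 hlt) h0
  have hs0' : (0 : ℝ) < s := by exact_mod_cast pos_iff_ne_zero.2 hs0
  -- `U > c` on a neighbourhood of `s`
  have hev : ∀ᶠ r in 𝓝 s, c < U r ω := (hc.tendsto s).eventually (lt_mem_nhds hlt)
  rw [Metric.eventually_nhds_iff] at hev
  obtain ⟨δ, hδ, hδ'⟩ := hev
  -- a rational time in `(s - δ, s) ∩ (0, s)`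
  obtain ⟨q, hq1, hq2⟩ := exists_rat_btwn (max_lt (sub_lt_self (s : ℝ) hδ) hs0')
  have hq0 : (0 : ℝ) < q := (le_max_right _ _).trans_lt hq1
  have hqs : (q : ℝ).toNNReal < s := by
    rw [← NNReal.coe_lt_coe, Real.coe_toNNReal _ hq0.le]; exact hq2
  have hdist : dist (q : ℝ).toNNReal s < δ := by
    rw [NNReal.dist_eq, Real.coe_toNNReal _ hq0.le, abs_sub_comm, abs_of_pos (sub_pos.2 hq2)]
    linarith [(le_max_left _ _).trans_lt hq1]
  have hcq : c < U (q : ℝ).toNNReal ω := hδ' hdist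
  have := hs.trans (ratExceed_le hcq)
  exact (not_lt.2 (WithTop.coe_le_coe.1 this)) hqs

/-- Along a continuous path the optional times `ratExceed U c` exceed any given time for all
large levels `c`. [folklore] -/
theorem eventually_lt_ratExceed {ω : Ω} (hc : Continuous (U · ω)) (T : ℝ≥0) :
    ∀ᶠ c in atTop, (T : WithTop ℝ≥0) < ratExceed U c ω := by
  -- `U(·, ω)` is bounded on the compact `[0, T + 1]`
  obtain ⟨M, hM⟩ : ∃ M, ∀ r ∈ Set.Icc (0 : ℝ≥0) (T + 1), U r ω ≤ M := by
    have hK : IsCompact (Set.Icc (0 : ℝ≥0) (T + 1)) := isCompact_Icc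
    obtain ⟨M, hM⟩ := (hK.image_of_continuousOn hc.continuousOn).isBounded.bddAbove
    exact ⟨M, fun r hr ↦ hM ⟨r, hr, rfl⟩⟩
  filter_upwards [eventually_ge_atTop M] with c hc'
  have h1 : ((T + 1 : ℝ≥0) : WithTop ℝ≥0) ≤ ratExceed U c ω :=
    le_ratExceed_of_forall fun q hq ↦ (hM _ ⟨zero_le, hq⟩).trans hc'
  refine lt_of_lt_of_le ?_ h1
  exact_mod_cast lt_add_one T

end RatExceed

/-! ### Paths of stopped processes; the event `{⊥ < τ}` -/

section Paths

variable {𝓕 : Filtration ℝ≥0 m}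

/-- The capped clock `i ↦ i ∧ x` (read in `ℝ≥0`) is continuous for every `x : WithTop ℝ≥0`.
[folklore] -/
theorem continuous_untopA_min (x : WithTop ℝ≥0) :
    Continuous fun i : ℝ≥0 ↦ (min (i : WithTop ℝ≥0) x).untopA := by
  induction x using WithTop.recTopCoe with
  | top => simp only [le_top, min_eq_left, WithTop.untopA, WithTop.untopD_coe]; exact continuous_id
  | coe r =>
    have h : ∀ i : ℝ≥0, (min (i : WithTop ℝ≥0) (r : WithTop ℝ≥0)).untopA = min i r := by
      intro i
      rw [← WithTop.coe_min, WithTop.untopA, WithTop.untopD_coe]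
    simp_rw [h]
    exact continuous_id.min continuous_const

/-- Stopping preserves continuity of a path: if `i ↦ Y i ω` is continuous then so is
`i ↦ (stoppedProcess Y ρ) i ω = Y (i ∧ ρ ω) ω`. Same statement and signature as
`Literature.Analysis.FunctionSpaces.continuous_stoppedProcess_apply` of `Literature.Analysis.FunctionSpaces.ItoProcessesProofs`
(above the Itô stack, not importable here; a librarian may redirect that copy to this one).
[folklore] -/
private theorem continuous_stoppedProcess_path {Y : ℝ≥0 → Ω → ℝ} {ω : Ω} (h : Continuous (Y · ω))
    (ρ : Ω → WithTop ℝ≥0) : Continuous fun i ↦ stoppedProcess Y ρ i ω :=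
  h.comp (continuous_untopA_min (ρ ω))

/-- A.s. continuity of paths is preserved by stopping. [folklore] -/
theorem ae_continuous_stoppedProcess {P : Measure Ω} {Y : ℝ≥0 → Ω → ℝ} {ρ : Ω → WithTop ℝ≥0}
    (h : ∀ᵐ ω ∂P, Continuous (Y · ω)) :
    ∀ᵐ ω ∂P, Continuous fun i ↦ stoppedProcess Y ρ i ω := by
  filter_upwards [h] with ω hω using Literature.Probability.Process.continuous_stoppedProcess_path hω ρ

/-- For a stopping time `τ` of a filtration of `ℝ≥0`, the event `{⊥ < τ} = {0 < τ}` (the event on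
which Mathlib's localised process `𝟙_{⊥ < τ} X` is not killed) belongs to `𝓕 ⊥ = 𝓕 0`.
[folklore] -/
theorem _root_.MeasureTheory.IsStoppingTime.measurableSet_bot_lt {τ : Ω → WithTop ℝ≥0}
    (hτ : IsStoppingTime 𝓕 τ) : MeasurableSet[𝓕 ⊥] {ω | ⊥ < τ ω} := by
  have h := hτ.measurableSet_gt (⊥ : ℝ≥0)
  simpa only [WithTop.coe_bot] using h

/-- The indicator weight `𝟙_{⊥ < τ}` is strongly `𝓕 ⊥`-measurable. [folklore] -/
theorem _root_.MeasureTheory.IsStoppingTime.stronglyMeasurable_indicator_bot_lt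
    {τ : Ω → WithTop ℝ≥0} (hτ : IsStoppingTime 𝓕 τ) :
    StronglyMeasurable[𝓕 ⊥] ({ω | ⊥ < τ ω}.indicator fun _ ↦ (1 : ℝ)) :=
  stronglyMeasurable_const.indicator hτ.measurableSet_bot_lt

/-- Unfolding of Mathlib's localised process: `(𝟙_{⊥ < τ} X)^τ_i ω = 𝟙_{⊥ < τ}(ω) · X_{i ∧ τ} ω`.
[folklore] -/
theorem stoppedProcess_indicator_apply (X : ℝ≥0 → Ω → ℝ) (τ : Ω → WithTop ℝ≥0) (i : ℝ≥0)
    (ω : Ω) :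
    stoppedProcess (fun i ↦ {ω | ⊥ < τ ω}.indicator (X i)) τ i ω =
      {ω | ⊥ < τ ω}.indicator (fun _ ↦ (1 : ℝ)) ω * stoppedProcess X τ i ω := by
  simp only [stoppedProcess]
  by_cases hω : ω ∈ {ω | ⊥ < τ ω}
  · rw [Set.indicator_of_mem hω, Set.indicator_of_mem hω, one_mul]
  · rw [Set.indicator_of_notMem hω, Set.indicator_of_notMem hω, zero_mul]

/-- An optional time `ρ` is a measurable map to `WithTop ℝ≥0` for the ambient σ-algebra, hence
events such as `{t < ρ}` or `{ρ ≤ t}` are measurable. [folklore] -/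
theorem IsOptionalTime.measurable {ρ : Ω → WithTop ℝ≥0} (hρ : IsOptionalTime 𝓕 ρ) :
    Measurable ρ := by
  refine measurable_of_Iio fun x ↦ ?_
  induction x using WithTop.recTopCoe with
  | top =>
    have : ρ ⁻¹' Set.Iio ⊤ = ⋃ n : ℕ, {ω | ρ ω < (n : ℝ≥0)} := by
      ext ω
      simp only [Set.mem_preimage, Set.mem_Iio, Set.mem_iUnion, Set.mem_setOf_eq]
      constructor
      · intro h
        obtain ⟨r, hr⟩ := WithTop.ne_top_iff_exists.1 h.ne
        obtain ⟨n, hn⟩ := exists_nat_gt r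
        exact ⟨n, by rw [← hr]; exact_mod_cast hn⟩
      · rintro ⟨n, hn⟩
        exact lt_of_lt_of_le hn le_top
    rw [this]
    exact MeasurableSet.iUnion fun n ↦ 𝓕.le _ _ (hρ n)
  | coe t => exact 𝓕.le t _ (hρ t)

end Paths

end Literature.Probability.Process
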